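import Summits.Ventures.Crystal3D.Bulk.GapTightLevels
import Mathlib.Geometry.Euclidean.Angle.Unoriented.Basic
import HarnessLib

/-!
# Corner-angle rows of the GAP census: R-min and R-tri at shell balls and at the intruder
# (DESIGN-L12-THEORY P-L2(b),(c) corner bounds / §P-L4 rows R-min, R-tri; Musin–Tarasov 2012
# Props. 3.6 (ii), 3.7 at two contact levels)

HONEST FRAMING. Part of the venture `Summits/Ventures/Crystal3D` (cell `pub-crystal3d`, phase 2,
24-hour sprint `PLAN.md` R42/R43; seat typer-bulk-2). The census LP (`TARGET-GAP.md` §4.5,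
`phase2/ENV-CENSUS/DESIGN-L12-THEORY.md` §P-L4) has the face angles ("corners") at every vertex of
the tight graph as variables, with the rows R-min (every corner is at least `α₀ = arccos (1/3)`
between two shell contacts at a shell ball, at least `A_x(ρ)` between a shell contact and the
hole contact, at least `A_p(ρ)` between two hole contacts at the intruder) and R-tri (equality
for tight triangles). THIS file proves these rows for EVERY admissible fourteen-ball
configuration (`IsGapConfig`; no extremality), as statements about the angle
`corner c i j k` at the direction `gapDir c i` between the great-circle arcs towards
`gapDir c j` and `gapDir c k` (the angle between the tangent components, tree `tangentProj`):

* two-level tangent lemmas in any real inner product space (`inner_tangentProj_le_twoLevel`,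
  `inner_tangentProj_eq_twoLevel`, `norm_tangentProj_eq_sqrt`, `arccos_le_angle_tangentProj`,
  `angle_tangentProj_eq_arccos`): at a unit `v`, neighbours `u, u'` at levels `κ₁, κ₂` with
  `⟪u, u'⟫ ≤ K` subtend an angle `≥ arccos ((K − κ₁κ₂)/(√(1−κ₁²) √(1−κ₂²)))` (spherical law of
  cosines as an inequality; the tree's `inner_tangentProj_le` is `κ₁ = κ₂ = K`);
* `IsGapConfig.arccos_third_le_corner` (R-min, shell ball, two shell contacts: `≥ arccos (1/3)`,
  `70.53°`) and `IsGapConfig.corner_eq_arccos_third` (R-tri, x-triangle);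
* `IsGapConfig.arccos_Ax_le_corner` (R-min, shell ball, a shell contact and the hole contact:
  `≥ A_x = arccos (D/(√3 √(4 − D²)))`, `D = intruderDist c = 2 cos ρ`) and
  `IsGapConfig.corner_eq_arccos_Ax` (R-tri, p-triangle at a shell corner);
* `IsGapConfig.arccos_Ap_le_corner` (R-min at the intruder: `≥ A_p = arccos ((2 − D²)/(4 − D²))`
  `= arccos ((1/2 − cos²ρ)/sin²ρ)`) and `IsGapConfig.corner_eq_arccos_Ap` (R-tri, p-triangle at
  `p`).

The numerical consequences (degree `≤ 5` at shell balls with the intruder counted, `≤ 4` at the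
intruder for `ρ < 58.28°`) are `Bulk/GapDegreesSharp.lean`; the upper bound "every corner
`< 180°`" needs extremality (P-L2(a), `Bulk/GapNoHalfPlane.lean`) and is not restated here.
Nothing is claimed about GAP(1.26).
-/

noncomputable section

open scoped BigOperators InnerProductSpace
open Finset Real

namespace Summit.Ventures.Crystal3D

/-! ## Corner angles at a vertex between two tight neighbours (rows R-min / R-tri) -/

section Corner

open Literature.Geometry.DiscreteGeometry InnerProductGeometry

variable {F : Type*} [NormedAddCommGroup F] [InnerProductSpace ℝ F]

/-- **Two-level tangent bound.** For a unit vector `v` and vectors `u, u'` at levels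
`⟪v, u⟫ = κ₁`, `⟪v, u'⟫ = κ₂` with `⟪u, u'⟫ ≤ K`, the tangent components at `v` satisfy
`⟪t_v u, t_v u'⟫ ≤ K − κ₁ κ₂` (one-level case `κ₁ = κ₂ = K = κ`: the tree's
`inner_tangentProj_le`, Musin–Tarasov 2012 Prop. 3.6 (ii)). -/
theorem inner_tangentProj_le_twoLevel {v u u' : F} (hv : ‖v‖ = 1) {κ₁ κ₂ K : ℝ}
    (hu : ⟪v, u⟫_ℝ = κ₁) (hu' : ⟪v, u'⟫_ℝ = κ₂) (huu' : ⟪u, u'⟫_ℝ ≤ K) :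
    ⟪tangentProj v u, tangentProj v u'⟫_ℝ ≤ K - κ₁ * κ₂ := by
  rw [inner_tangentProj v u u' hv, hu, hu']
  linarith

/-- Two-level tangent identity for a tight triple: `⟪u, u'⟫ = K` gives
`⟪t_v u, t_v u'⟫ = K − κ₁ κ₂` (one-level case: the tree's `inner_tangentProj_eq`, Prop. 3.7). -/
theorem inner_tangentProj_eq_twoLevel {v u u' : F} (hv : ‖v‖ = 1) {κ₁ κ₂ K : ℝ}
    (hu : ⟪v, u⟫_ℝ = κ₁) (hu' : ⟪v, u'⟫_ℝ = κ₂) (huu' : ⟪u, u'⟫_ℝ = K) :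
    ⟪tangentProj v u, tangentProj v u'⟫_ℝ = K - κ₁ * κ₂ := by
  rw [inner_tangentProj v u u' hv, hu, hu', huu']

/-- Norm of a tangent component: `‖t_v u‖ = √(1 − κ²)` for unit `v, u` at level `κ`. -/
theorem norm_tangentProj_eq_sqrt {v u : F} (hv : ‖v‖ = 1) (hu : ‖u‖ = 1) {κ : ℝ}
    (hκ : ⟪v, u⟫_ℝ = κ) : ‖tangentProj v u‖ = √(1 - κ ^ 2) := by
  rw [← hκ, ← norm_sq_tangentProj hv hu, Real.sqrt_sq (norm_nonneg _)]

/-- **The corner angle at `v` between two tight neighbours is at least the two-level bound.**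
For unit `v, u, u'` with `⟪v, u⟫ = κ₁`, `⟪v, u'⟫ = κ₂`, `κ₁² < 1`, `κ₂² < 1` and `⟪u, u'⟫ ≤ K`,
the angle at `v` between the great-circle arcs `vu`, `vu'` — the angle between the tangent
components `t_v u`, `t_v u'` — satisfies
`cos ∠ ≤ (K − κ₁κ₂) / (√(1 − κ₁²) √(1 − κ₂²))`, i.e.
`arccos ((K − κ₁κ₂)/(√(1 − κ₁²) √(1 − κ₂²))) ≤ ∠`. (Spherical law of cosines as an inequality;
Musin–Tarasov 2012 Prop. 3.6 (ii) is `κ₁ = κ₂ = K`.) -/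
theorem arccos_le_angle_tangentProj {v u u' : F} (hv : ‖v‖ = 1) (hun : ‖u‖ = 1)
    (hun' : ‖u'‖ = 1) {κ₁ κ₂ K : ℝ} (hu : ⟪v, u⟫_ℝ = κ₁) (hu' : ⟪v, u'⟫_ℝ = κ₂) (hκ₁ : κ₁ ^ 2 < 1)
    (hκ₂ : κ₂ ^ 2 < 1) (huu' : ⟪u, u'⟫_ℝ ≤ K) :
    Real.arccos ((K - κ₁ * κ₂) / (√(1 - κ₁ ^ 2) * √(1 - κ₂ ^ 2))) ≤
      angle (tangentProj v u) (tangentProj v u') := by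
  have h1 : ‖tangentProj v u‖ = √(1 - κ₁ ^ 2) := norm_tangentProj_eq_sqrt hv hun hu
  have h2 : ‖tangentProj v u'‖ = √(1 - κ₂ ^ 2) := norm_tangentProj_eq_sqrt hv hun' hu'
  have hpos : 0 < √(1 - κ₁ ^ 2) * √(1 - κ₂ ^ 2) :=
    mul_pos (Real.sqrt_pos.2 (by linarith)) (Real.sqrt_pos.2 (by linarith))
  unfold angle
  rw [h1, h2]
  exact Real.antitone_arccos (div_le_div_of_nonneg_right
    (inner_tangentProj_le_twoLevel hv hu hu' huu') hpos.le)

/-- **Equality for a tight triple**: if moreover `⟪u, u'⟫ = K` then the corner angle is exactly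
`arccos ((K − κ₁κ₂)/(√(1 − κ₁²) √(1 − κ₂²)))`. -/
theorem angle_tangentProj_eq_arccos {v u u' : F} (hv : ‖v‖ = 1) (hun : ‖u‖ = 1)
    (hun' : ‖u'‖ = 1) {κ₁ κ₂ K : ℝ} (hu : ⟪v, u⟫_ℝ = κ₁) (hu' : ⟪v, u'⟫_ℝ = κ₂)
    (huu' : ⟪u, u'⟫_ℝ = K) :
    angle (tangentProj v u) (tangentProj v u') =
      Real.arccos ((K - κ₁ * κ₂) / (√(1 - κ₁ ^ 2) * √(1 - κ₂ ^ 2))) := by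
  unfold angle
  rw [norm_tangentProj_eq_sqrt hv hun hu, norm_tangentProj_eq_sqrt hv hun' hu',
    inner_tangentProj_eq_twoLevel hv hu hu' huu']

end Corner

section ConfigCorner

open Literature.Geometry.DiscreteGeometry InnerProductGeometry

variable {c : Fin 14 → EuclideanSpace ℝ (Fin 3)}

/-- The **corner angle** at ball `i` between the tight arcs towards balls `j` and `k`: the angle
at the direction `gapDir c i` between the great-circle arcs to `gapDir c j` and `gapDir c k`,
i.e. the angle between their tangent components at `gapDir c i` (the face angles `u` of the
census LP, DESIGN-L12-THEORY §P-L4 B). -/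
def corner (c : Fin 14 → EuclideanSpace ℝ (Fin 3)) (i j k : Fin 14) : ℝ :=
  angle (tangentProj (gapDir c i) (gapDir c j)) (tangentProj (gapDir c i) (gapDir c k))

/-- The corner angle is symmetric in the two neighbours. -/
theorem corner_comm (c : Fin 14 → EuclideanSpace ℝ (Fin 3)) (i j k : Fin 14) :
    corner c i j k = corner c i k j :=
  angle_comm _ _

/-- **Row R-min at a shell ball between two shell contacts: corner `≥ α₀ = arccos (1/3)`**
(`70.53°`, the angle of the spherical triangle with three `60°` sides). For every admissible
configuration, at a shell ball `i` touching shell balls `j ≠ k`: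
`arccos (1/3) ≤ corner c i j k`. (DESIGN-L12-THEORY P-L2b / §P-L4 R-min; MT12 Prop. 3.6 (ii)
at `ψ = 60°`.) -/
theorem IsGapConfig.arccos_third_le_corner (hc : IsGapConfig c) {i j k : Fin 14} (hi0 : i ≠ 0)
    (hi13 : i ≠ 13) (hj0 : j ≠ 0) (hj13 : j ≠ 13) (hk0 : k ≠ 0) (hk13 : k ≠ 13)
    (hij : dist (c i) (c j) = 1) (hik : dist (c i) (c k) = 1) (hjk : j ≠ k) :
    Real.arccos (1 / 3) ≤ corner c i j k := by
  have h1 := hc.inner_gapDir_eq hi0 hj0 hij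
  have h2 := hc.inner_gapDir_eq hi0 hk0 hik
  have h3 := hc.inner_gapDir_le hj0 hk0 hjk
  rw [tightLevel_of_ne hi13 hj13] at h1
  rw [tightLevel_of_ne hi13 hk13] at h2
  rw [tightLevel_of_ne hj13 hk13] at h3
  have h := arccos_le_angle_tangentProj (hc.norm_gapDir hi0) (hc.norm_gapDir hj0)
    (hc.norm_gapDir hk0) h1 h2 (by norm_num) (by norm_num) h3
  have e : ((1 : ℝ) / 2 - 1 / 2 * (1 / 2)) / (√(1 - (1 / 2) ^ 2) * √(1 - (1 / 2) ^ 2)) = 1 / 3 := by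
    rw [Real.mul_self_sqrt (by norm_num)]; norm_num
  rw [e] at h
  exact h

/-- **Row R-tri (x-triangle): the corners of a tight shell triangle are exactly `α₀`.** At a
shell ball `i` touching shell balls `j, k` which touch each other: `corner c i j k = arccos (1/3)`.
(MT12 Prop. 3.7 at `ψ = 60°`.) -/
theorem IsGapConfig.corner_eq_arccos_third (hc : IsGapConfig c) {i j k : Fin 14} (hi0 : i ≠ 0)
    (hi13 : i ≠ 13) (hj0 : j ≠ 0) (hj13 : j ≠ 13) (hk0 : k ≠ 0) (hk13 : k ≠ 13)
    (hij : dist (c i) (c j) = 1) (hik : dist (c i) (c k) = 1) (hjk : dist (c j) (c k) = 1) :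
    corner c i j k = Real.arccos (1 / 3) := by
  have h1 := hc.inner_gapDir_eq hi0 hj0 hij
  have h2 := hc.inner_gapDir_eq hi0 hk0 hik
  have h3 := hc.inner_gapDir_eq hj0 hk0 hjk
  rw [tightLevel_of_ne hi13 hj13] at h1
  rw [tightLevel_of_ne hi13 hk13] at h2
  rw [tightLevel_of_ne hj13 hk13] at h3
  have h := angle_tangentProj_eq_arccos (hc.norm_gapDir hi0) (hc.norm_gapDir hj0)
    (hc.norm_gapDir hk0) h1 h2 h3
  have e : ((1 : ℝ) / 2 - 1 / 2 * (1 / 2)) / (√(1 - (1 / 2) ^ 2) * √(1 - (1 / 2) ^ 2)) = 1 / 3 := by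
    rw [Real.mul_self_sqrt (by norm_num)]; norm_num
  rw [e] at h
  exact h

/-- `√(1 − (1/2)²) = √3/2`. -/
theorem sqrt_one_sub_half_sq : √(1 - (1 / 2 : ℝ) ^ 2) = √3 / 2 := by
  have h3 : (√3 / 2) ^ 2 = 3 / 4 := by rw [div_pow, Real.sq_sqrt (by norm_num)]; norm_num
  rw [show (1 : ℝ) - (1 / 2) ^ 2 = 3 / 4 by norm_num, ← h3]
  exact Real.sqrt_sq (by positivity)

/-- `√(1 − (D/2)²) = √(4 − D²)/2`. -/
theorem sqrt_one_sub_half_mul_sq (D : ℝ) : √(1 - (D / 2) ^ 2) = √(4 - D ^ 2) / 2 := by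
  rw [show (1 : ℝ) - (D / 2) ^ 2 = (4 - D ^ 2) / 4 by ring, Real.sqrt_div' _ (by norm_num : (0:ℝ) ≤ 4),
    show (4 : ℝ) = 2 ^ 2 by norm_num, Real.sqrt_sq (by norm_num : (0:ℝ) ≤ 2)]

/-- **Row R-min at a shell ball between a shell contact and the hole contact: corner
`≥ A_x(ρ) = arccos (D / (√3 · √(4 − D²)))`** (`D = intruderDist c = 2 cos ρ`). For every
admissible configuration with `D < 2`, at a shell ball `i` touching the shell ball `j` and the
intruder: `arccos (D/(√3 √(4 − D²))) ≤ corner c i j 13`. (DESIGN-L12-THEORY P-L2b, "corner at `x`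
`≥ A_x(ρ*)` (one nbr `p`)"; §P-L4 R-min.) -/
theorem IsGapConfig.arccos_Ax_le_corner (hc : IsGapConfig c) (hD : intruderDist c < 2)
    {i j : Fin 14} (hi0 : i ≠ 0) (hi13 : i ≠ 13) (hj0 : j ≠ 0) (hj13 : j ≠ 13)
    (hij : dist (c i) (c j) = 1) (hi : dist (c i) (c 13) = 1) :
    Real.arccos (intruderDist c / (√3 * √(4 - intruderDist c ^ 2))) ≤ corner c i j 13 := by
  set D := intruderDist c with hD_def
  have hD1 : 1 ≤ D := hc.one_le_intruderDist
  have h1 := hc.inner_gapDir_eq hi0 hj0 hij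
  have h2 := hc.inner_gapDir_eq hi0 (by decide : (13 : Fin 14) ≠ 0) hi
  have h3 := hc.inner_gapDir_le hj0 (by decide : (13 : Fin 14) ≠ 0) hj13
  rw [tightLevel_of_ne hi13 hj13] at h1
  rw [tightLevel_of_right] at h2 h3
  have h := arccos_le_angle_tangentProj (hc.norm_gapDir hi0) (hc.norm_gapDir hj0)
    (hc.norm_gapDir (by decide : (13 : Fin 14) ≠ 0)) h1 h2 (by norm_num) (by nlinarith) h3
  have hs3 : √3 ≠ 0 := (Real.sqrt_pos.2 (by norm_num)).ne'
  have hs4 : √(4 - D ^ 2) ≠ 0 := (Real.sqrt_pos.2 (by nlinarith)).ne'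
  have e : (D / 2 - 1 / 2 * (D / 2)) / (√(1 - (1 / 2) ^ 2) * √(1 - (D / 2) ^ 2)) =
      D / (√3 * √(4 - D ^ 2)) := by
    rw [sqrt_one_sub_half_sq, sqrt_one_sub_half_mul_sq,
      div_eq_div_iff (by positivity) (mul_ne_zero hs3 hs4)]
    ring
  rw [e] at h
  exact h

/-- **Row R-tri (p-triangle, corner at a shell ball): exactly `A_x(ρ)`.** At a shell ball `i`
touching the shell ball `j` and the intruder, with `j` also touching the intruder:
`corner c i j 13 = arccos (D/(√3 √(4 − D²)))`. -/
theorem IsGapConfig.corner_eq_arccos_Ax (hc : IsGapConfig c) (hD : intruderDist c < 2)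
    {i j : Fin 14} (hi0 : i ≠ 0) (hi13 : i ≠ 13) (hj0 : j ≠ 0) (hj13 : j ≠ 13)
    (hij : dist (c i) (c j) = 1) (hi : dist (c i) (c 13) = 1) (hj : dist (c j) (c 13) = 1) :
    corner c i j 13 = Real.arccos (intruderDist c / (√3 * √(4 - intruderDist c ^ 2))) := by
  set D := intruderDist c with hD_def
  have hD1 : 1 ≤ D := hc.one_le_intruderDist
  have h1 := hc.inner_gapDir_eq hi0 hj0 hij
  have h2 := hc.inner_gapDir_eq hi0 (by decide : (13 : Fin 14) ≠ 0) hi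
  have h3 := hc.inner_gapDir_eq hj0 (by decide : (13 : Fin 14) ≠ 0) hj
  rw [tightLevel_of_ne hi13 hj13] at h1
  rw [tightLevel_of_right] at h2 h3
  have h := angle_tangentProj_eq_arccos (hc.norm_gapDir hi0) (hc.norm_gapDir hj0)
    (hc.norm_gapDir (by decide : (13 : Fin 14) ≠ 0)) h1 h2 h3
  have hs3 : √3 ≠ 0 := (Real.sqrt_pos.2 (by norm_num)).ne'
  have hs4 : √(4 - D ^ 2) ≠ 0 := (Real.sqrt_pos.2 (by nlinarith)).ne'
  have e : (D / 2 - 1 / 2 * (D / 2)) / (√(1 - (1 / 2) ^ 2) * √(1 - (D / 2) ^ 2)) =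
      D / (√3 * √(4 - D ^ 2)) := by
    rw [sqrt_one_sub_half_sq, sqrt_one_sub_half_mul_sq,
      div_eq_div_iff (by positivity) (mul_ne_zero hs3 hs4)]
    ring
  rw [e] at h
  exact h

/-- **Row R-min at the intruder: corner `≥ A_p(ρ) = arccos ((2 − D²)/(4 − D²))`**
(`= arccos ((1/2 − cos²ρ)/sin²ρ)`, `D = 2 cos ρ`). For every admissible configuration with
`D < 2`, at the intruder between two shell balls `j ≠ k` touching it:
`arccos ((2 − D²)/(4 − D²)) ≤ corner c 13 j k`. (DESIGN-L12-THEORY P-L2c, "corner at `p`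
`≥ A_p(ρ*)`"; §P-L4 R-min; this is the bound behind `deg p ≤ 4` for `ρ < 58.28°`.) -/
theorem IsGapConfig.arccos_Ap_le_corner (hc : IsGapConfig c) (hD : intruderDist c < 2)
    {j k : Fin 14} (hj0 : j ≠ 0) (hj13 : j ≠ 13) (hk0 : k ≠ 0) (hk13 : k ≠ 13)
    (hj : dist (c j) (c 13) = 1) (hk : dist (c k) (c 13) = 1) (hjk : j ≠ k) :
    Real.arccos ((2 - intruderDist c ^ 2) / (4 - intruderDist c ^ 2)) ≤ corner c 13 j k := by
  set D := intruderDist c with hD_def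
  have hD1 : 1 ≤ D := hc.one_le_intruderDist
  have h13 : (13 : Fin 14) ≠ 0 := by decide
  have h1 := hc.inner_gapDir_eq h13 hj0 (by rw [dist_comm]; exact hj)
  have h2 := hc.inner_gapDir_eq h13 hk0 (by rw [dist_comm]; exact hk)
  have h3 := hc.inner_gapDir_le hj0 hk0 hjk
  rw [tightLevel_of_left] at h1 h2
  rw [tightLevel_of_ne hj13 hk13] at h3
  have h := arccos_le_angle_tangentProj (hc.norm_gapDir h13) (hc.norm_gapDir hj0)
    (hc.norm_gapDir hk0) h1 h2 (by nlinarith) (by nlinarith) h3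
  have h4 : (4 : ℝ) - D ^ 2 ≠ 0 := by nlinarith
  have h4' : (1 : ℝ) - (D / 2) ^ 2 ≠ 0 := by nlinarith
  have e : (1 / 2 - D / 2 * (D / 2)) / (√(1 - (D / 2) ^ 2) * √(1 - (D / 2) ^ 2)) =
      (2 - D ^ 2) / (4 - D ^ 2) := by
    rw [Real.mul_self_sqrt (by nlinarith), div_eq_div_iff h4' h4]
    ring
  rw [e] at h
  exact h

/-- **Row R-tri (p-triangle, corner at the intruder): exactly `A_p(ρ)`.** At the intruder
between two shell balls `j, k` touching it and touching each other:
`corner c 13 j k = arccos ((2 − D²)/(4 − D²))`. -/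
theorem IsGapConfig.corner_eq_arccos_Ap (hc : IsGapConfig c) (hD : intruderDist c < 2)
    {j k : Fin 14} (hj0 : j ≠ 0) (hj13 : j ≠ 13) (hk0 : k ≠ 0) (hk13 : k ≠ 13)
    (hj : dist (c j) (c 13) = 1) (hk : dist (c k) (c 13) = 1) (hjk : dist (c j) (c k) = 1) :
    corner c 13 j k = Real.arccos ((2 - intruderDist c ^ 2) / (4 - intruderDist c ^ 2)) := by
  set D := intruderDist c with hD_def
  have hD1 : 1 ≤ D := hc.one_le_intruderDist
  have h13 : (13 : Fin 14) ≠ 0 := by decide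
  have h1 := hc.inner_gapDir_eq h13 hj0 (by rw [dist_comm]; exact hj)
  have h2 := hc.inner_gapDir_eq h13 hk0 (by rw [dist_comm]; exact hk)
  have h3 := hc.inner_gapDir_eq hj0 hk0 hjk
  rw [tightLevel_of_left] at h1 h2
  rw [tightLevel_of_ne hj13 hk13] at h3
  have h := angle_tangentProj_eq_arccos (hc.norm_gapDir h13) (hc.norm_gapDir hj0)
    (hc.norm_gapDir hk0) h1 h2 h3
  have h4 : (4 : ℝ) - D ^ 2 ≠ 0 := by nlinarith
  have h4' : (1 : ℝ) - (D / 2) ^ 2 ≠ 0 := by nlinarith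
  have e : (1 / 2 - D / 2 * (D / 2)) / (√(1 - (D / 2) ^ 2) * √(1 - (D / 2) ^ 2)) =
      (2 - D ^ 2) / (4 - D ^ 2) := by
    rw [Real.mul_self_sqrt (by nlinarith), div_eq_div_iff h4' h4]
    ring
  rw [e] at h
  exact h

/-- **Every corner is `< 180°` is NOT a general fact** (it needs extremality, P-L2a: the tree's
`IsReducedExtremal.exists_inner_pos`); but every corner is `≤ π` and `≥ 0` by definition of the
angle. -/
theorem corner_le_pi (c : Fin 14 → EuclideanSpace ℝ (Fin 3)) (i j k : Fin 14) :
    corner c i j k ≤ Real.pi :=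
  angle_le_pi _ _

end ConfigCorner

end Summit.Ventures.Crystal3D
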